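import Summits.Ventures.PercRepro.C025ProfileGirthThinAll

/-!
# EVERY ROW `(q, u)` OF (Π) AT GIRTH `≥ q+1`, AND C-025 AT EVERY `(p, q)` AT GIRTH `≥ q+1` (night-3 g20)

With the thin half of every row in the companion module (`thinIneq_all`), the fat half at level `q + j`: a fat rank-`q`
set `X` (`≥ q + 1` points) is paid by its `j`-SETS `X ∪ Y`, `Y ⊆ E ∖ X` of `j` points with `ρ(X ∪ Y) = q + j`:
* `eq_of_union_jset_eq` — a `j`-set of `X` determines `X` (different closures: `|X ∩ X'| ≤ q − 1` and
  `ρ(X ∪ Y) ≤ 2q + j − |X'| ≤ q + j − 1`);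
* `choose_add_le_choose_mul_choose` — `C(t+q, j) ≤ C(q+j, j) · C(t, j)` for `j ≤ t` (Vandermonde);
* `card_jsets_ge` — at least `C(ρ(E) − q, j)` `j`-sets (the `j`-subsets of a base of `M` through a basis of `X`, minus it);
* **`price_le_card_jsets`** — `price_{q,q+j}(X) ≤ #{j-sets of X}`; **`fatIneq_all`** — the fat half;
* **`profileIneq_add_of_girth (q j) (hq : 1 ≤ q) (hg) : Profile.ProfileIneq M q (q + j)`** and
  **`profileIneq_of_girth_all_rows (q u) (hq : 1 ≤ q) (hqu : q < u) (hg) : Profile.ProfileIneq M q u`** — EVERY ROW OF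
  (Π) (C-032) AT GIRTH `≥ q + 1`, EVERY RANK;
* **`rls_of_girth_all_rows (p q) (hq : 1 ≤ q) (hg) : ThmN.RLS M p q`** — C-025 AT EVERY `(p, q)`, `q ≥ 1`,
  ON EVERY FINITE MATROID IN WHICH EVERY SET OF AT MOST `q` POINTS IS INDEPENDENT (the girth condition no longer grows
  with `p`; g18 / g19 / the companion modules had girth `≥ p − 1`, `≥ p − 2`).
No `def`, no `instance`, no notation.  Axioms: standard.
-/

open scoped Matroid

namespace PercRepro

open Set Finset ThmH Staged

namespace GirthRows

variable {α : Type} [DecidableEq α] {M : Matroid α} [M.Finite]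

/-- A point of a `j`-set of `X` lies outside `cl X`. -/
theorem notMem_closure_of_mem_jset {q j : ℕ} {X Y : Finset α} (hXg : X ⊆ gr M) (hXr : rkN M X = q)
    (hY : Y ∈ ((gr M \ X).powersetCard j).filter (fun Y => rkN M (X ∪ Y) = q + j)) {y : α} (hy : y ∈ Y) :
    y ∉ M.closure (X : Set α) := by
  rw [Finset.mem_filter, Finset.mem_powersetCard] at hY
  obtain ⟨⟨hYg, hYc⟩, hYr⟩ := hY
  intro hyc
  have hyg : y ∈ gr M := (Finset.mem_sdiff.1 (hYg hy)).1
  have h1 : rkN M (insert y X) = rkN M X := ((mem_closure_iff_rkN_insert hXg hyg).1 hyc)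
  have hsub : insert y X ⊆ X ∪ Y := by
    intro z hz
    rw [Finset.mem_insert] at hz
    rcases hz with rfl | hz
    · exact Finset.mem_union_right _ hy
    · exact Finset.mem_union_left _ hz
  have h2 := rkN_le_rkN_add_card_sdiff (M := M) hsub
  have h3 : ((X ∪ Y) \ insert y X).card ≤ j - 1 := by
    have : (X ∪ Y) \ insert y X ⊆ Y.erase y := by
      intro z hz
      rw [Finset.mem_sdiff, Finset.mem_union, Finset.mem_insert] at hz
      rw [Finset.mem_erase]
      push Not at hz
      exact ⟨hz.2.1, hz.1.resolve_left hz.2.2⟩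
    have := Finset.card_le_card this
    rw [Finset.card_erase_of_mem hy, hYc] at this
    exact this
  have hj1 : 1 ≤ j := by
    rw [← hYc]
    exact Finset.card_pos.2 ⟨y, hy⟩
  omega

/-- **A `j`-set determines its fat set.** -/
theorem eq_of_union_jset_eq {q j : ℕ} (hq : 1 ≤ q) (hg : ∀ T ⊆ M.E, T.encard ≤ q → M.Indep T)
    {X X' Y Y' : Finset α} (hXg : X ⊆ gr M) (hX'g : X' ⊆ gr M) (hXr : rkN M X = q) (hX'r : rkN M X' = q)
    (hX'c : q + 1 ≤ X'.card)
    (hY : Y ∈ ((gr M \ X).powersetCard j).filter (fun Y => rkN M (X ∪ Y) = q + j))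
    (hY' : Y' ∈ ((gr M \ X').powersetCard j).filter (fun Y => rkN M (X' ∪ Y) = q + j))
    (heq : X ∪ Y = X' ∪ Y') : X = X' := by
  have hYmem := hY
  have hY'mem := hY'
  rw [Finset.mem_filter, Finset.mem_powersetCard] at hYmem hY'mem
  obtain ⟨⟨hYg, hYc⟩, hYr⟩ := hYmem
  obtain ⟨⟨hY'g, _⟩, _⟩ := hY'mem
  by_cases hcl : M.closure (X : Set α) = M.closure (X' : Set α)
  · have hX'X : X' ⊆ X := by
      intro z hz
      have hzS : z ∈ X ∪ Y := heq ▸ Finset.mem_union_left _ hz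
      rw [Finset.mem_union] at hzS
      rcases hzS with h | h
      · exact h
      · exfalso
        apply notMem_closure_of_mem_jset hXg hXr hY h
        rw [hcl]
        exact M.mem_closure_of_mem hz (by rw [← coe_gr]; exact_mod_cast hX'g)
    have hXX' : X ⊆ X' := by
      intro z hz
      have hzS : z ∈ X' ∪ Y' := heq ▸ Finset.mem_union_left _ hz
      rw [Finset.mem_union] at hzS
      rcases hzS with h | h
      · exact h
      · exfalso
        apply notMem_closure_of_mem_jset hX'g hX'r hY' h
        rw [← hcl]
        exact M.mem_closure_of_mem hz (by rw [← coe_gr]; exact_mod_cast hXg)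
    exact Finset.Subset.antisymm hXX' hX'X
  · exfalso
    have hinter := card_inter_le_of_closure_ne hg hXg hX'g hXr hX'r hcl
    have hX'sub : X' ⊆ X ∪ Y := heq ▸ Finset.subset_union_left
    -- `Y ∩ X' = X' ∖ X`
    have hYX : Disjoint Y X := by
      rw [Finset.disjoint_left]
      intro z hzY hzX
      exact (Finset.mem_sdiff.1 (hYg hzY)).2 hzX
    have hYX' : Y ∩ X' = X' \ X := by
      ext z
      rw [Finset.mem_inter, Finset.mem_sdiff]
      constructor
      · rintro ⟨hzY, hzX'⟩
        exact ⟨hzX', Finset.disjoint_left.1 hYX hzY⟩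
      · rintro ⟨hzX', hzX⟩
        have := hX'sub hzX'
        rw [Finset.mem_union] at this
        exact ⟨this.resolve_left hzX, hzX'⟩
    -- `X ∪ Y = (X ∪ X') ∪ (Y ∖ X')`
    have hsub : X ∪ X' ⊆ X ∪ Y := Finset.union_subset Finset.subset_union_left hX'sub
    have hr1 := rkN_le_rkN_add_card_sdiff (M := M) hsub
    have hc1 : ((X ∪ Y) \ (X ∪ X')).card ≤ (Y \ X').card := by
      apply Finset.card_le_card
      intro z hz
      rw [Finset.mem_sdiff, Finset.mem_union, Finset.mem_union] at hz
      rw [Finset.mem_sdiff]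
      push Not at hz
      exact ⟨hz.1.resolve_left hz.2.1, hz.2.2⟩
    have hc2 : (Y \ X').card + (Y ∩ X').card = Y.card := Finset.card_sdiff_add_card_inter Y X'
    have hc3 : (X' \ X).card + (X' ∩ X).card = X'.card := Finset.card_sdiff_add_card_inter X' X
    rw [hYX'] at hc2
    rw [Finset.inter_comm] at hc3
    -- submodularity and the girth on `X ∩ X'`
    have hsm := ThinTriangle.rkN_inter_add_union_le (M := M) X X'
    have hg' : ∀ T ⊆ M.E, T.encard ≤ (((X ∩ X').card : ℕ) : ℕ∞) → M.Indep T :=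
      fun T hT h => hg T hT (h.trans (by exact_mod_cast (by omega : (X ∩ X').card ≤ q)))
    have hir : rkN M (X ∩ X') = (X ∩ X').card :=
      rkN_eq_of_card_eq_of_girth hg' ((Finset.inter_subset_left).trans hXg) rfl
    omega

/-- A `j`-set of a fat set is a level-`(q+j)` set with at least `q + j + 1` points. -/
theorem union_jset_mem_levelSet {q j : ℕ} {X Y : Finset α} (hXg : X ⊆ gr M) (hXc : q + 1 ≤ X.card)
    (hY : Y ∈ ((gr M \ X).powersetCard j).filter (fun Y => rkN M (X ∪ Y) = q + j)) :
    X ∪ Y ∈ Shadow.levelSet M (q + j) ∧ q + j + 1 ≤ (X ∪ Y).card := by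
  rw [Finset.mem_filter, Finset.mem_powersetCard] at hY
  obtain ⟨⟨hYg, hYc⟩, hYr⟩ := hY
  refine ⟨?_, ?_⟩
  · rw [Profile.mem_levelSet]
    refine ⟨Finset.union_subset hXg (hYg.trans Finset.sdiff_subset), ?_⟩
    rw [← Staged.coe_rkN, hYr]
  · have hd : Disjoint X Y := by
      rw [Finset.disjoint_left]
      intro z hzX hzY
      exact (Finset.mem_sdiff.1 (hYg hzY)).2 hzX
    rw [Finset.card_union_of_disjoint hd, hYc]
    omega

/-- `C(t+q, j) ≤ C(q+j, j) · C(t, j)` for `j ≤ t` (Vandermonde termwise: `C(t, i) ≤ C(t, j) · C(j, i)`). -/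
theorem choose_add_le_choose_mul_choose (t q j : ℕ) (hjt : j ≤ t) :
    (t + q).choose j ≤ (q + j).choose j * t.choose j := by
  rw [Nat.add_choose_eq t q j, show q + j = j + q by omega, Nat.add_choose_eq j q j, Finset.sum_mul]
  apply Finset.sum_le_sum
  intro ij hij
  rw [Finset.HasAntidiagonal.mem_antidiagonal] at hij
  have hi : ij.1 ≤ j := by omega
  have h1 : t.choose ij.1 ≤ t.choose j * j.choose ij.1 := by
    have := Nat.choose_mul (n := t) (k := j) (s := ij.1) hi
    rw [this]
    have hpos : 1 ≤ (t - ij.1).choose (j - ij.1) := Nat.choose_pos (by omega)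
    calc t.choose ij.1 = t.choose ij.1 * 1 := (mul_one _).symm
      _ ≤ t.choose ij.1 * (t - ij.1).choose (j - ij.1) := Nat.mul_le_mul_left _ hpos
  calc t.choose ij.1 * q.choose ij.2 ≤ t.choose j * j.choose ij.1 * q.choose ij.2 := Nat.mul_le_mul_right _ h1
    _ = j.choose ij.1 * q.choose ij.2 * t.choose j := by ring

open scoped Classical in
/-- **At least `C(ρ(E) − q, j)` `j`-sets**: a base of `M` through a basis of `X`, minus it, has `ρ(E) − q` points outside
`X`, and each of its `j`-subsets `Y` has `ρ(X ∪ Y) = q + j`. -/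
theorem card_jsets_ge {q j : ℕ} {X : Finset α} (hXg : X ⊆ gr M) (hXr : rkN M X = q) :
    (rkN M (gr M) - q).choose j ≤ (((gr M \ X).powersetCard j).filter (fun Y => rkN M (X ∪ Y) = q + j)).card := by
  have hXE : (X : Set α) ⊆ M.E := by rw [← coe_gr]; exact_mod_cast hXg
  obtain ⟨I, hI⟩ := M.exists_isBasis (X : Set α) hXE
  obtain ⟨Z, hZ, hIZ⟩ := hI.indep.subset_isBasis_of_subset (hI.subset.trans hXE) (Set.Subset.refl _)
  have hfin : Z.Finite := M.ground_finite.subset hZ.subset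
  set Zf := hfin.toFinset with hZf
  have hZfg : Zf ⊆ gr M := by
    rw [hZf, Set.Finite.toFinset_subset, coe_gr]
    exact hZ.subset
  have hZfi : M.Indep (Zf : Set α) := by rw [hZf, Set.Finite.coe_toFinset]; exact hZ.indep
  have hZfc : Zf.card = rkN M (gr M) := by
    have h1 := hZ.encard_eq_eRk
    rw [← Set.Finite.coe_toFinset hfin, Set.encard_coe_eq_coe_finsetCard, ← coe_gr, ← Staged.coe_rkN] at h1
    exact_mod_cast h1
  -- `Zf ∩ X = I`, so `#(Zf ∖ X) = ρ(E) − q`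
  have hIfin : I.Finite := M.ground_finite.subset hI.indep.subset_ground
  have hZX : ((Zf ∩ X : Finset α) : Set α) = I := by
    symm
    apply hI.eq_of_subset_indep
    · exact hZfi.subset (Finset.coe_subset.2 Finset.inter_subset_left)
    · intro z hz
      rw [Finset.mem_coe, Finset.mem_inter, hZf, Set.Finite.mem_toFinset]
      exact ⟨hIZ hz, Finset.mem_coe.1 (hI.subset hz)⟩
    · exact Finset.coe_subset.2 Finset.inter_subset_right
  have hIc : (Zf ∩ X).card = q := by
    have h1 := hI.encard_eq_eRk
    rw [← hZX, Set.encard_coe_eq_coe_finsetCard, ← Staged.coe_rkN, hXr] at h1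
    exact_mod_cast h1
  have hWc : (Zf \ X).card = rkN M (gr M) - q := by
    have := Finset.card_sdiff_add_card_inter Zf X
    omega
  -- every `j`-subset of `Zf ∖ X` is a `j`-set of `X`
  have hsub : (Zf \ X).powersetCard j ⊆ ((gr M \ X).powersetCard j).filter (fun Y => rkN M (X ∪ Y) = q + j) := by
    intro Y hY
    rw [Finset.mem_powersetCard] at hY
    rw [Finset.mem_filter, Finset.mem_powersetCard]
    refine ⟨⟨hY.1.trans (Finset.sdiff_subset_sdiff hZfg (Finset.Subset.refl _)), hY.2⟩, ?_⟩
    apply le_antisymm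
    · have := rkN_le_rkN_add_card_sdiff (M := M) (Finset.subset_union_left : X ⊆ X ∪ Y)
      have hc : ((X ∪ Y) \ X).card ≤ Y.card := Finset.card_le_card (by
        intro z hz
        rw [Finset.mem_sdiff, Finset.mem_union] at hz
        exact hz.1.resolve_left hz.2)
      omega
    · -- `(Zf ∩ X) ∪ Y ⊆ X ∪ Y` is independent with `q + j` points
      have hsub' : (Zf ∩ X) ∪ Y ⊆ X ∪ Y := Finset.union_subset_union Finset.inter_subset_right (Finset.Subset.refl _)
      have hind : M.Indep (((Zf ∩ X) ∪ Y : Finset α) : Set α) := by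
        apply hZfi.subset
        rw [Finset.coe_union]
        apply Set.union_subset
        · exact Finset.coe_subset.2 Finset.inter_subset_left
        · exact Finset.coe_subset.2 (hY.1.trans Finset.sdiff_subset)
      have hd : Disjoint (Zf ∩ X) Y := by
        rw [Finset.disjoint_left]
        intro z hz hzY
        exact (Finset.mem_sdiff.1 (hY.1 hzY)).2 (Finset.mem_inter.1 hz).2
      have h1 : rkN M ((Zf ∩ X) ∪ Y) = q + j := by
        rw [Staged.rkN_eq_iff, hind.eRk_eq_encard, Set.encard_coe_eq_coe_finsetCard,
          Finset.card_union_of_disjoint hd, hIc, hY.2]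
      rw [← h1]
      exact rkN_mono hsub'
  have := Finset.card_le_card hsub
  rw [Finset.card_powersetCard, hWc] at this
  exact this

open scoped Classical in
/-- **The fat price is at most the number of `j`-sets**: `price_{q,q+j}(X) ≤ #{j-sets of X}` for every rank-`q` set `X`
(`ρ(E ∖ X) ≤ ρ(E)` and `C(ρ(E), j) ≤ C(q+j, j) · C(ρ(E) − q, j)`). -/
theorem price_le_card_jsets {q j : ℕ} {X : Finset α} (hXg : X ⊆ gr M) (hXr : rkN M X = q) :
    Profile.price M q (q + j) X ≤
      ((((gr M \ X).powersetCard j).filter (fun Y => rkN M (X ∪ Y) = q + j)).card : ℚ) := by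
  unfold Profile.price
  split_ifs with hthr
  · set p := rkN M (gr M \ X) with hp
    have hpdef : (M.eRk ((gr M \ X : Finset α) : Set α)).toNat = p := rfl
    rw [hpdef]
    have hpq : q + j ≤ p := by
      have h := hthr
      rw [← Staged.coe_rkN] at h
      exact_mod_cast h
    set r := rkN M (gr M) with hr
    have hpr : p ≤ r := rkN_mono Finset.sdiff_subset
    have hrq : q ≤ r := by rw [← hXr]; exact rkN_mono hXg
    have hjt : j ≤ r - q := by omega
    -- `C(p+q, q+j)/C(p+q, q) = C(p, j)/C(q+j, j) ≤ C(r, j)/C(q+j, j) ≤ C(r − q, j) ≤ #{j-sets}`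
    have hid := choose_add_mul_choose_eq p q j
    have hvan := choose_add_le_choose_mul_choose (r - q) q j hjt
    have hrq' : r - q + q = r := by omega
    rw [hrq'] at hvan
    have hcnt := card_jsets_ge (M := M) (j := j) hXg hXr
    have hpos1 : (0 : ℚ) < ((p + q).choose q : ℕ) := by exact_mod_cast Nat.choose_pos (by omega)
    have hpos2 : (0 : ℚ) < ((q + j).choose j : ℕ) := by exact_mod_cast Nat.choose_pos (by omega)
    rw [div_le_iff₀ hpos1]
    -- in ℕ: `C(p+q, q+j) · C(q+j, j) = C(p+q, q) · C(p, j) ≤ C(p+q, q) · C(r, j) ≤ C(p+q,q) · C(q+j,j) · C(r−q, j)`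
    have hnat : (p + q).choose (q + j) * (q + j).choose j ≤
        (p + q).choose q * ((q + j).choose j * (((gr M \ X).powersetCard j).filter
          (fun Y => rkN M (X ∪ Y) = q + j)).card) := by
      calc (p + q).choose (q + j) * (q + j).choose j = (p + q).choose q * p.choose j := hid
        _ ≤ (p + q).choose q * r.choose j := Nat.mul_le_mul_left _ (Nat.choose_le_choose j hpr)
        _ ≤ (p + q).choose q * ((q + j).choose j * (r - q).choose j) := Nat.mul_le_mul_left _ hvan
        _ ≤ (p + q).choose q * ((q + j).choose j * (((gr M \ X).powersetCard j).filter
            (fun Y => rkN M (X ∪ Y) = q + j)).card) :=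
            Nat.mul_le_mul_left _ (Nat.mul_le_mul_left _ hcnt)
    have hQ : (((p + q).choose (q + j) : ℕ) : ℚ) * ((q + j).choose j : ℕ) ≤
        (((p + q).choose q : ℕ) : ℚ) * (((q + j).choose j : ℕ) *
          ((((gr M \ X).powersetCard j).filter (fun Y => rkN M (X ∪ Y) = q + j)).card : ℚ)) := by
      exact_mod_cast hnat
    have := le_of_mul_le_mul_right (a := (((q + j).choose j : ℕ) : ℚ)) (by
      calc (((p + q).choose (q + j) : ℕ) : ℚ) * ((q + j).choose j : ℕ) ≤ _ := hQ
        _ = ((((gr M \ X).powersetCard j).filter (fun Y => rkN M (X ∪ Y) = q + j)).card : ℚ) *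
            (((p + q).choose q : ℕ) : ℚ) * ((q + j).choose j : ℕ) := by ring) hpos2
    exact this
  · exact Nat.cast_nonneg _

open scoped Classical in
/-- **THE FAT HALF AT LEVEL `q + j`**: `Σ_{B ∈ Rq, #B ≠ q} price_{q,q+j}(B) ≤ #{S : ρ(S) = q + j, #S ≥ q + j + 1}`
(girth `≥ q + 1`, `q ≥ 1`). -/
theorem fatIneq_all {q j : ℕ} (hq : 1 ≤ q) (hg : ∀ T ⊆ M.E, T.encard ≤ q → M.Indep T) :
    ∑ B ∈ (Profile.Rq M q).filter (fun B : Finset α => ¬ B.card = q), Profile.price M q (q + j) B ≤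
      (((Shadow.levelSet M (q + j)).filter (fun S : Finset α => q + j + 1 ≤ S.card)).card : ℚ) := by
  set F := (Profile.Rq M q).filter (fun B : Finset α => ¬ B.card = q) with hF
  have hFmem : ∀ B ∈ F, B ⊆ gr M ∧ rkN M B = q ∧ q + 1 ≤ B.card := by
    intro B hB
    rw [hF, Finset.mem_filter, Profile.mem_Rq] at hB
    refine ⟨hB.1.1, ?_, ?_⟩
    · rw [Staged.rkN_eq_iff]
      exact hB.1.2
    · have h1 : rkN M B ≤ B.card := rkN_le_card B
      have h2 : rkN M B = q := by rw [Staged.rkN_eq_iff]; exact hB.1.2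
      omega
  have h1 : ∑ B ∈ F, Profile.price M q (q + j) B ≤
      ∑ B ∈ F, ((((gr M \ B).powersetCard j).filter (fun Y => rkN M (B ∪ Y) = q + j)).card : ℚ) := by
    apply Finset.sum_le_sum
    intro B hB
    exact price_le_card_jsets (hFmem B hB).1 (hFmem B hB).2.1
  have h2 : ∑ B ∈ F, ((((gr M \ B).powersetCard j).filter (fun Y => rkN M (B ∪ Y) = q + j)).card : ℚ) =
      ((F.sigma (fun B => ((gr M \ B).powersetCard j).filter (fun Y => rkN M (B ∪ Y) = q + j))).card : ℚ) := by
    rw [Finset.card_sigma]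
    push_cast
    rfl
  have h3 : (F.sigma (fun B => ((gr M \ B).powersetCard j).filter (fun Y => rkN M (B ∪ Y) = q + j))).card ≤
      ((Shadow.levelSet M (q + j)).filter (fun S : Finset α => q + j + 1 ≤ S.card)).card := by
    apply Finset.card_le_card_of_injOn (fun a : (Σ _ : Finset α, Finset α) => a.1 ∪ a.2)
    · intro a ha
      rw [Finset.mem_coe, Finset.mem_sigma] at ha
      obtain ⟨hBg, _, hBc⟩ := hFmem a.1 ha.1
      rw [Finset.mem_coe, Finset.mem_filter]
      exact union_jset_mem_levelSet hBg hBc ha.2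
    · intro a ha a' ha' heq
      rw [Finset.mem_coe, Finset.mem_sigma] at ha ha'
      obtain ⟨hBg, hBr, _⟩ := hFmem a.1 ha.1
      obtain ⟨hB'g, hB'r, hB'c⟩ := hFmem a'.1 ha'.1
      simp only at heq
      have hB : a.1 = a'.1 := eq_of_union_jset_eq hq hg hBg hB'g hBr hB'r hB'c ha.2 ha'.2 heq
      have hYd : ∀ (B Y : Finset α), Y ∈ ((gr M \ B).powersetCard j).filter (fun Y => rkN M (B ∪ Y) = q + j) →
          (B ∪ Y) \ B = Y := by
        intro B Y hY
        rw [Finset.mem_filter, Finset.mem_powersetCard] at hY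
        apply Finset.union_sdiff_cancel_left
        rw [Finset.disjoint_left]
        intro z hzB hzY
        exact (Finset.mem_sdiff.1 (hY.1.1 hzY)).2 hzB
      have hY : a.2 = a'.2 := by
        rw [← hYd a.1 a.2 ha.2, ← hYd a'.1 a'.2 ha'.2, heq, hB]
      exact Sigma.ext hB (heq_of_eq hY)
  calc ∑ B ∈ F, Profile.price M q (q + j) B
      ≤ ∑ B ∈ F, ((((gr M \ B).powersetCard j).filter (fun Y => rkN M (B ∪ Y) = q + j)).card : ℚ) := h1
    _ = _ := h2
    _ ≤ _ := by exact_mod_cast h3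

open scoped Classical in
/-- **THE ROW `(q, q + j)` OF (Π) AT GIRTH `≥ q + 1`** for every `j ≥ 1`, every rank: the thin half (`thinIneq_all`) is at
most the independent `(q+j)`-sets, the fat half (`fatIneq_all`) at most the level sets with `≥ q + j + 1` points. -/
theorem profileIneq_add_of_girth (q j : ℕ) (hq : 1 ≤ q)
    (hg : ∀ T ⊆ M.E, T.encard ≤ q → M.Indep T) : Profile.ProfileIneq M q (q + j) := by
  unfold Profile.ProfileIneq
  rw [← Finset.sum_filter_add_sum_filter_not (Profile.Rq M q) (fun B : Finset α => B.card = q)]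
  rw [← Finset.card_filter_add_card_filter_not (fun S : Finset α => S.card = q + j) (s := Shadow.levelSet M (q + j))]
  have hthin := thinIneq_all (M := M) (q := q) (j := j) hg
  have hfat := fatIneq_all (M := M) (q := q) (j := j) hq hg
  -- independent `(q+j)`-sets are level sets of `q + j` points
  have hind : ((((gr M).powersetCard (q + j)).filter (fun U : Finset α => M.Indep (U : Set α))).card : ℚ) ≤
      (((Shadow.levelSet M (q + j)).filter (fun S : Finset α => S.card = q + j)).card : ℚ) := by
    apply Nat.cast_le.2
    apply Finset.card_le_card
    intro U hU
    rw [Finset.mem_filter, Finset.mem_powersetCard] at hU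
    rw [Finset.mem_filter, Profile.mem_levelSet]
    refine ⟨⟨hU.1.1, ?_⟩, hU.1.2⟩
    rw [hU.2.eRk_eq_encard, Set.encard_coe_eq_coe_finsetCard, hU.1.2]
  have hbig : (((Shadow.levelSet M (q + j)).filter (fun S : Finset α => q + j + 1 ≤ S.card)).card : ℚ) ≤
      (((Shadow.levelSet M (q + j)).filter (fun S : Finset α => ¬ S.card = q + j)).card : ℚ) := by
    apply Nat.cast_le.2
    apply Finset.card_le_card
    intro S hS
    rw [Finset.mem_filter] at hS ⊢
    exact ⟨hS.1, by omega⟩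
  push_cast
  linarith

/-- **EVERY ROW `(q, u)`, `q < u`, OF (Π) (C-032) AT GIRTH `≥ q + 1`** (`q ≥ 1`), every rank. -/
theorem profileIneq_of_girth_all_rows (q u : ℕ) (hq : 1 ≤ q) (hqu : q < u)
    (hg : ∀ T ⊆ M.E, T.encard ≤ q → M.Indep T) : Profile.ProfileIneq M q u := by
  obtain ⟨j, rfl⟩ : ∃ j, u = q + j := ⟨u - q, by omega⟩
  exact profileIneq_add_of_girth q j hq hg

/-- **C-025 AT EVERY `(p, q)`, `p > q ≥ 1`, ON EVERY FINITE MATROID IN WHICH EVERY SET OF AT MOST `q` POINTS IS INDEPENDENT**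
— the girth condition `≥ q + 1` does not grow with `p`. -/
theorem rls_of_girth_all_rows (p q : ℕ) (hq : 1 ≤ q)
    (hg : ∀ T ⊆ M.E, T.encard ≤ q → M.Indep T) : ThmN.RLS M p q := by
  apply rls_of_profileIneq_rows
  intro u hqu _
  exact profileIneq_of_girth_all_rows q u hq hqu hg

end GirthRows

end PercRepro
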